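import Summits.Ventures.Crystal3D.Theorems.StickyWulffConstantPolycrystalWulffBoundRadialMassInner
import Summits.Ventures.Crystal3D.Theorems.StickyWulffConstantPolycrystalWulffBoundGenericShiftGrid52

/-!
# `PolycrystalWulffBound`, line `PolyDensity`: the GENERIC SHIFT LEMMA at `θ = 13/25` (four radial
# shells) — across a wall between two ARBITRARY lattices the cdf shift is at most `0.52`
# (crux `stmt-Ventures-19482`; cf-p1 DECISION (lxiv) «13/25 insurance rung»: g30 picks the generic
# charge `c₀ ∈ {13/25, 11/20}` by the rule «largest P-certified θ with G-inf − θ ≥ 0.03»)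

Route `StickyWulffConstant` of the venture `Summits/Ventures/Crystal3D`, second prover lane (poly-p2,
gen 16).  Sharpening of `cruxWulffBody_cap_shift_eleven_twentieths` (gen 15, three shells, worth `0.520`
— just short of `13/25`) by one more rotation-invariant number, the INNER shell at radius `7/4`
(`…RadialMassInner`: `a_X(q) ≥ cap_{7/4}(q) − 4·cap_{7/4}(√3)`, subtracted constant `0.0071`), which
moves the radial certificate to `0.5072`: for EVERY pair of frames `A, B`, every unit normal `n` and every
level `s`,

  `|W(A) ∩ {s + 13/25 < ⟪y,n⟫}| ≤ |W(B) ∩ {s < ⟪y,n⟫}|`   (`cruxWulffBody_cap_shift_thirteen_twentyfifths`).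

ARCHITECTURE (new, pointwise): five cells `[0,.97]·[.97,1.25]·[1.25,1.6]·[1.6,1.66]·[1.66,1.7161]` on
each of which ONE pair of envelope forms (upper `cap₂ + 0.969` / `cap_{53/25} + 0.092` / `cap_{√5}`; lower
`cap₂ − π(64/3 − 12√3)` / `cap_{7/4} − 0.0071` / `cap_{√3}`) is compared POINTWISE in `s`
(`shift52_cell1..5` of `…GenericShiftGrid52`: the defect is a convex quadratic in `s`, so the two endpoint
facts per cell suffice — no monotone-grid loss, 11 numerical facts in all); empty cap for
`s ≥ √5 − 13/25`, median for `s ∈ [−13/50, 0]`, complements (`a_X(τ) + a_X(−τ) = 32`) for `s < −13/50`.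
NUMBERS (memo P-L2-g16): sharp constant `√5 − √3 = 0.50402`; this four-shell certificate is worth `0.5072`.
WHAT THIS IS NOT: the sharp constant; a statement about co-axial pairs; the crux is not claimed.
-/

noncomputable section

open scoped BigOperators InnerProductSpace ENNReal Pointwise
open MeasureTheory Set

namespace Summit.Ventures.Crystal3D.Theorems

open Summit.Ventures.Crystal3D.Cruxes.TextureLiminf.TexShadow (E3)

open Literature.MathematicalPhysics.StatisticalMechanics (fccStacking)

/-! ### One pointwise step -/

/-- A pointwise step: `a_A(s + θ) ≤ u ≤ l ≤ a_B(s)` gives `a_A(s + θ) ≤ a_B(s)`. -/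
theorem cruxWulffBody_cap_shift_of_pointwise (A B : E3 ≃ₗᵢ[ℝ] E3) (n : E3) {θ s u l : ℝ}
    (hU : volume ({y : E3 | ∀ ν : E3, ⟪y, ν⟫_ℝ ≤ Real.sqrt 2 / 4 *
        ∑ᶠ w ∈ {w | w ∈ fccStacking 1 (Real.sqrt (2 / 3)) ∧ ‖w‖ = 1}, |⟪w, A.symm ν⟫_ℝ|} ∩
        {y : E3 | s + θ < ⟪y, n⟫_ℝ}) ≤ ENNReal.ofReal u)
    (hul : u ≤ l)
    (hL : ENNReal.ofReal l ≤ volume ({y : E3 | ∀ ν : E3, ⟪y, ν⟫_ℝ ≤ Real.sqrt 2 / 4 *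
        ∑ᶠ w ∈ {w | w ∈ fccStacking 1 (Real.sqrt (2 / 3)) ∧ ‖w‖ = 1}, |⟪w, B.symm ν⟫_ℝ|} ∩
        {y : E3 | s < ⟪y, n⟫_ℝ})) :
    volume ({y : E3 | ∀ ν : E3, ⟪y, ν⟫_ℝ ≤ Real.sqrt 2 / 4 *
        ∑ᶠ w ∈ {w | w ∈ fccStacking 1 (Real.sqrt (2 / 3)) ∧ ‖w‖ = 1}, |⟪w, A.symm ν⟫_ℝ|} ∩
        {y : E3 | s + θ < ⟪y, n⟫_ℝ}) ≤
      volume ({y : E3 | ∀ ν : E3, ⟪y, ν⟫_ℝ ≤ Real.sqrt 2 / 4 *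
        ∑ᶠ w ∈ {w | w ∈ fccStacking 1 (Real.sqrt (2 / 3)) ∧ ‖w‖ = 1}, |⟪w, B.symm ν⟫_ℝ|} ∩
        {y : E3 | s < ⟪y, n⟫_ℝ}) :=
  hU.trans ((ENNReal.ofReal_le_ofReal hul).trans hL)

/-! ### The generic shift lemma at `θ = 13/25` -/

/-- **Generic cdf shift ≤ 13/25, the half-line `s ≥ −13/50`.** -/
theorem cruxWulffBody_cap_shift_thirteen_twentyfifths_of_ge (A B : E3 ≃ₗᵢ[ℝ] E3) {n : E3} (hn : ‖n‖ = 1)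
    {s : ℝ} (hs : -13 / 50 ≤ s) :
    volume ({y : E3 | ∀ ν : E3, ⟪y, ν⟫_ℝ ≤ Real.sqrt 2 / 4 *
        ∑ᶠ w ∈ {w | w ∈ fccStacking 1 (Real.sqrt (2 / 3)) ∧ ‖w‖ = 1}, |⟪w, A.symm ν⟫_ℝ|} ∩
        {y : E3 | s + 13 / 25 < ⟪y, n⟫_ℝ}) ≤
      volume ({y : E3 | ∀ ν : E3, ⟪y, ν⟫_ℝ ≤ Real.sqrt 2 / 4 *
        ∑ᶠ w ∈ {w | w ∈ fccStacking 1 (Real.sqrt (2 / 3)) ∧ ‖w‖ = 1}, |⟪w, B.symm ν⟫_ℝ|} ∩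
        {y : E3 | s < ⟪y, n⟫_ℝ}) := by
  set WA : Set E3 := {y : E3 | ∀ ν : E3, ⟪y, ν⟫_ℝ ≤ Real.sqrt 2 / 4 *
        ∑ᶠ w ∈ {w | w ∈ fccStacking 1 (Real.sqrt (2 / 3)) ∧ ‖w‖ = 1}, |⟪w, A.symm ν⟫_ℝ|} with hWA
  set WB : Set E3 := {y : E3 | ∀ ν : E3, ⟪y, ν⟫_ℝ ≤ Real.sqrt 2 / 4 *
        ∑ᶠ w ∈ {w | w ∈ fccStacking 1 (Real.sqrt (2 / 3)) ∧ ‖w‖ = 1}, |⟪w, B.symm ν⟫_ℝ|} with hWB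
  obtain ⟨h3lo, h3hi, h5lo, h5hi, -, -, -, -, -, -, -, -⟩ := shift_grid_constants
  have h5pos : 0 < Real.sqrt 5 := Real.sqrt_pos.2 (by norm_num)
  have h3pos : 0 < Real.sqrt 3 := Real.sqrt_pos.2 (by norm_num)
  have hR3 : (2 : ℝ) ≤ (53 : ℝ) / 25 := by norm_num
  have h3R4 : Real.sqrt 3 ≤ (7 : ℝ) / 4 := by linarith
  have hR42 : (7 : ℝ) / 4 ≤ 2 := by norm_num
  by_cases htop : Real.sqrt 5 - 13 / 25 ≤ s
  · have hempty : WA ∩ {y : E3 | s + 13 / 25 < ⟪y, n⟫_ℝ} = ∅ := by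
      ext y
      simp only [mem_inter_iff, mem_setOf_eq, mem_empty_iff_false, iff_false, not_and, not_lt]
      intro hy
      have hy5 : ‖y‖ ≤ Real.sqrt 5 := mem_closedBall_zero_iff.1 (cruxWulffBody_subset_closedBall A hy)
      have h1 : ⟪y, n⟫_ℝ ≤ ‖y‖ * ‖n‖ := real_inner_le_norm _ _
      rw [hn, mul_one] at h1
      linarith
    rw [hempty, measure_empty]
    exact bot_le
  rw [not_le] at htop
  by_cases h0 : s < 0
  · calc volume (WA ∩ {y : E3 | s + 13 / 25 < ⟪y, n⟫_ℝ})
        ≤ volume (WA ∩ {y : E3 | (13 : ℝ) / 50 < ⟪y, n⟫_ℝ}) :=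
          measure_mono (inter_subset_inter_right _ fun y (hy : s + 13 / 25 < ⟪y, n⟫_ℝ) => by
            show (13 : ℝ) / 50 < ⟪y, n⟫_ℝ; linarith)
      _ ≤ ENNReal.ofReal (Real.pi * (16 / 3 - 4 * ((13 : ℝ) / 50) + ((13 : ℝ) / 50) ^ 3 / 3) +
            (16 + 16 * Real.pi - 12 * Real.pi * Real.sqrt 3)) :=
          volume_cruxWulffBody_cap_le_shell A hn (q := (13 : ℝ) / 50) (by norm_num) (by norm_num)
      _ ≤ ENNReal.ofReal 16 := ENNReal.ofReal_le_ofReal shift52_median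
      _ = volume (WB ∩ {y : E3 | 0 < ⟪y, n⟫_ℝ}) := (volume_cruxWulffBody_cap_zero B hn).symm
      _ ≤ volume (WB ∩ {y : E3 | s < ⟪y, n⟫_ℝ}) :=
          measure_mono (inter_subset_inter_right _ fun y (hy : 0 < ⟪y, n⟫_ℝ) => by
            show s < ⟪y, n⟫_ℝ; linarith)
  rw [not_lt] at h0
  -- cell 1: `[0, 0.97]`, forms upper₂ / lower₂
  by_cases hc1 : s ≤ (0.97 : ℝ)
  · exact cruxWulffBody_cap_shift_of_pointwise A B n
      (volume_cruxWulffBody_cap_le_shell A hn (q := s + 13 / 25) (by linarith) (by linarith))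
      (shift52_cell1 h0 hc1)
      (volume_cruxWulffBody_cap_ge_shell B hn (q := s) h0 (by linarith))
  -- cell 2: `[0.97, 1.25]`, forms upper₃ / lower₂
  by_cases hc2 : s ≤ (1.25 : ℝ)
  · exact cruxWulffBody_cap_shift_of_pointwise A B n
      (volume_cruxWulffBody_cap_le_outerShell A hn (R := (53 : ℝ) / 25) (q := s + 13 / 25) hR3
        (by linarith) (by linarith))
      (shift52_cell2 (le_of_lt (not_le.1 hc1)) hc2)
      (volume_cruxWulffBody_cap_ge_shell B hn (q := s) h0 (by linarith))
  -- cell 3: `[1.25, 1.6]`, forms upper₃ / lower₄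
  by_cases hc3 : s ≤ (1.6 : ℝ)
  · exact cruxWulffBody_cap_shift_of_pointwise A B n
      (volume_cruxWulffBody_cap_le_outerShell A hn (R := (53 : ℝ) / 25) (q := s + 13 / 25) hR3
        (by linarith) (by linarith))
      (shift52_cell3 (le_of_lt (not_le.1 hc2)) hc3)
      (volume_cruxWulffBody_cap_ge_innerShell B hn (R := (7 : ℝ) / 4) (q := s) h3R4 hR42 h0
        (by linarith))
  -- cell 4: `[1.6, 1.66]`, forms upper_B / lower₄
  by_cases hc4 : s ≤ (1.66 : ℝ)
  · exact cruxWulffBody_cap_shift_of_pointwise A B n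
      ((volume_cruxWulffBody_cap_le_ball A n (s + 13 / 25)).trans (le_of_eq
        (volume_closedBall_inter_ioi hn h5pos (by linarith) (by linarith))))
      (shift52_cell4 (le_of_lt (not_le.1 hc3)) hc4)
      (volume_cruxWulffBody_cap_ge_innerShell B hn (R := (7 : ℝ) / 4) (q := s) h3R4 hR42 h0
        (by linarith))
  -- cell 5: `[1.66, 1.7161] ⊇ [1.66, √5 − 13/25)`, forms upper_B / lower_B
  exact cruxWulffBody_cap_shift_of_pointwise A B n
    ((volume_cruxWulffBody_cap_le_ball A n (s + 13 / 25)).trans (le_of_eq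
      (volume_closedBall_inter_ioi hn h5pos (by linarith) (by linarith))))
    (shift52_cell5 (le_of_lt (not_le.1 hc4)) (by linarith))
    ((le_of_eq (volume_closedBall_inter_ioi hn h3pos (by linarith) (by linarith)).symm).trans
      (volume_ball_cap_le_cruxWulffBody B n s))

/-- **Generic cdf shift ≤ 13/25**: for all frames `A, B`, unit `n` and `s`,
`|W(A) ∩ {s + 13/25 < ⟪y,n⟫}| ≤ |W(B) ∩ {s < ⟪y,n⟫}|`.  The half-line `s < −13/50` follows from
`s' = −s − 13/25 ≥ −13/50` with the frames swapped, by `a_X(τ) + a_X(−τ) = 32`. -/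
theorem cruxWulffBody_cap_shift_thirteen_twentyfifths (A B : E3 ≃ₗᵢ[ℝ] E3) {n : E3} (hn : ‖n‖ = 1) (s : ℝ) :
    volume ({y : E3 | ∀ ν : E3, ⟪y, ν⟫_ℝ ≤ Real.sqrt 2 / 4 *
        ∑ᶠ w ∈ {w | w ∈ fccStacking 1 (Real.sqrt (2 / 3)) ∧ ‖w‖ = 1}, |⟪w, A.symm ν⟫_ℝ|} ∩
        {y : E3 | s + 13 / 25 < ⟪y, n⟫_ℝ}) ≤
      volume ({y : E3 | ∀ ν : E3, ⟪y, ν⟫_ℝ ≤ Real.sqrt 2 / 4 *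
        ∑ᶠ w ∈ {w | w ∈ fccStacking 1 (Real.sqrt (2 / 3)) ∧ ‖w‖ = 1}, |⟪w, B.symm ν⟫_ℝ|} ∩
        {y : E3 | s < ⟪y, n⟫_ℝ}) := by
  by_cases hs : -13 / 50 ≤ s
  · exact cruxWulffBody_cap_shift_thirteen_twentyfifths_of_ge A B hn hs
  rw [not_le] at hs
  have hA := volume_cruxWulffBody_cap_add_cap_neg A hn (s + 13 / 25)
  have hB := volume_cruxWulffBody_cap_add_cap_neg B hn s
  have haux := cruxWulffBody_cap_shift_thirteen_twentyfifths_of_ge B A hn (s := -s - 13 / 25) (by linarith)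
  have heq : -s - 13 / 25 + 13 / 25 = -s := by ring
  rw [heq] at haux
  have heq2 : -(s + 13 / 25) = -s - 13 / 25 := by ring
  rw [heq2] at hA
  set aA := volume ({y : E3 | ∀ ν : E3, ⟪y, ν⟫_ℝ ≤ Real.sqrt 2 / 4 *
        ∑ᶠ w ∈ {w | w ∈ fccStacking 1 (Real.sqrt (2 / 3)) ∧ ‖w‖ = 1}, |⟪w, A.symm ν⟫_ℝ|} ∩
        {y : E3 | s + 13 / 25 < ⟪y, n⟫_ℝ}) with haA
  set aA' := volume ({y : E3 | ∀ ν : E3, ⟪y, ν⟫_ℝ ≤ Real.sqrt 2 / 4 *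
        ∑ᶠ w ∈ {w | w ∈ fccStacking 1 (Real.sqrt (2 / 3)) ∧ ‖w‖ = 1}, |⟪w, A.symm ν⟫_ℝ|} ∩
        {y : E3 | -s - 13 / 25 < ⟪y, n⟫_ℝ}) with haA'
  set aB := volume ({y : E3 | ∀ ν : E3, ⟪y, ν⟫_ℝ ≤ Real.sqrt 2 / 4 *
        ∑ᶠ w ∈ {w | w ∈ fccStacking 1 (Real.sqrt (2 / 3)) ∧ ‖w‖ = 1}, |⟪w, B.symm ν⟫_ℝ|} ∩
        {y : E3 | s < ⟪y, n⟫_ℝ}) with haB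
  set aB' := volume ({y : E3 | ∀ ν : E3, ⟪y, ν⟫_ℝ ≤ Real.sqrt 2 / 4 *
        ∑ᶠ w ∈ {w | w ∈ fccStacking 1 (Real.sqrt (2 / 3)) ∧ ‖w‖ = 1}, |⟪w, B.symm ν⟫_ℝ|} ∩
        {y : E3 | -s < ⟪y, n⟫_ℝ}) with haB'
  have hA'top : aA' ≠ ⊤ := by
    intro ht; rw [ht, add_top] at hA; exact ENNReal.ofReal_ne_top hA.symm
  have hB'top : aB' ≠ ⊤ := by
    intro ht; rw [ht, add_top] at hB; exact ENNReal.ofReal_ne_top hB.symm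
  have h1 : aA = ENNReal.ofReal 32 - aA' := ENNReal.eq_sub_of_add_eq hA'top hA
  have h2 : aB = ENNReal.ofReal 32 - aB' := ENNReal.eq_sub_of_add_eq hB'top hB
  rw [h1, h2]
  exact tsub_le_tsub_left haux _

end Summit.Ventures.Crystal3D.Theorems

end
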